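import Literature.NumberTheory.NumberFields.NotAlgebraicallyClosed
import Literature.IUT.HodgeTheaters.InitialThetaDataLocalGroups
import Literature.FieldTheory.FunctionField.RationalClosedPointResidues
import HarnessLib

/-!
# [IUTchI] Def. 3.1 (a), (b): at an initial Θ-datum, `G_F = Gal(F̄/F)` — hence `Π_{C_F} ↠ G_F` — moves a
# constant of `F̄` (and a constant rational function of `F̄(t)`)

S. Mochizuki, *Inter-universal Teichmüller theory I*, §3, Definition 3.1 (a) "`F` is a number field …
`F̄` is an algebraic closure of `F`", (b) "`G_F := Gal(F̄/F)`" (kurims final manuscript, May 2020, p. 61)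
[claim: Mochizuki2012, status: disputed].  PLUMBING over the REAL `InitialThetaData` of
`InitialThetaData.lean` (abc-iut-L5-t2): the elementary field-theoretic fact that the absolute Galois group
of a number field acts NON-TRIVIALLY on `F̄` (`Literature/NumberTheory/NumberFields/NotAlgebraicallyClosed.lean`:
a number field is not algebraically closed, and `F̄^{Gal(F̄/F)} = F`), instantiated at the datum's own
algebraic closure `Fbar` (field `isAlgClosure`), at the interface surjection `augGF : Π_{C_F} ↠ G_F`
(`InitialThetaDataLocalGroups.lean`, `augGF_surjective`) and at the identification `galIso : G ≃* Gal(F̄/F)` of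
`ThetaGeometry`, and at the coefficient action `f ↦ f^{σ}` on `F̄(t) = RatFunc F̄`
(`Literature.FieldTheory.FunctionField.ratFuncMapCoeffs`).

PURPOSE (abc-iut cell, GAP B `G-L5t9g8-1` = [IUTchI] Ex. 5.4 (iv), item GB-07 add-on; chair's RULINGS #354
(ii): "`hcoeff` dischargeable from `NumberField F`"): the non-vacuity lemmas of the reconstruction lane carry the
free hypothesis `(hcoeff : ∃ (σ : Fbar ≃ₐ[F] Fbar) (c : Fbar), σ c ≠ c)` —
`InitialThetaData.not_exists_reconEquivariantFor_of_act_eq_refl` (`FrobenioidBridgeEx54ivInfKappaRecon.lean`),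
`InitialThetaData.C2Residuals'.exists_act_ne_refl` (`FrobenioidBridgeEx54ivInfKappaReconData.lean`), and the
`hmove` hypothesis of the X-143 non-transparency lemma at the recorded coefficient action
`act _ g := ratFuncMapCoeffs (D.augGF g)` (spec-keeper B, `X143-CURE-DESIGN.md` (ii)/(iii)).  This file
DISCHARGES them at the datum: `D.exists_galois_apply_ne` is `hcoeff` verbatim, `D.exists_augGF_ratFuncMapCoeffs_ne`
is the `hmove` shape.

Pure field theory; nothing of the disputed series is asserted, no reconstruction statement ([AbsTopIII] Thm. 1.9)
is assumed or asserted, no side is taken on [IUTchIII] Cor. 3.12; no `instance`, no notation.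
-/

namespace Literature.IUT.HodgeTheaters

open Literature.FieldTheory.FunctionField

universe u v w

namespace InitialThetaData

variable {F : Type u} {K : Type v} {Fbar : Type w} [Field F] [NumberField F] [Field K]
  [NumberField K] [Algebra F K] [Field Fbar] [Algebra F Fbar] [Algebra K Fbar]
  {E : WeierstrassCurve F} [E.IsElliptic] {l : ℕ} {Pb : BadPlacePredicates K}
  (D : InitialThetaData F K Fbar E l Pb)

/-! ### `F̄/F` is Galois and `F̄ ≠ F` -/

include D in
/-- `F̄/F` is Galois: `F̄` is an algebraic closure of the number field `F` (Def. 3.1 (a); characteristic `0`).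
[claim: Mochizuki2012, status: disputed] -/
theorem isGalois_F : IsGalois F Fbar := by
  haveI := D.isAlgClosure
  exact Literature.NumberTheory.NumberFields.isGalois_of_isAlgClosure F Fbar

include D in
/-- `F̄ ≠ F`: some element of the datum's algebraic closure `F̄` is not in `F` (a number field is not
algebraically closed; Def. 3.1 (a)). [claim: Mochizuki2012, status: disputed] -/
theorem exists_not_mem_range_algebraMap : ∃ c : Fbar, c ∉ Set.range (algebraMap F Fbar) := by
  haveI := D.isAlgClosure
  haveI : IsAlgClosed Fbar := IsAlgClosure.isAlgClosed F
  exact Literature.NumberTheory.NumberFields.exists_not_mem_range_algebraMap F Fbar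

/-! ### `G_F` moves constants -/

include D in
/-- Every `c ∈ F̄ ∖ F` is moved by some `σ ∈ G_F = Gal(F̄/F)` (`F̄^{G_F} = F`; Def. 3.1 (a), (b)).
[claim: Mochizuki2012, status: disputed] -/
theorem exists_galois_apply_ne_of_not_mem_range {c : Fbar} (hc : c ∉ Set.range (algebraMap F Fbar)) :
    ∃ σ : Fbar ≃ₐ[F] Fbar, σ c ≠ c := by
  haveI := D.isAlgClosure
  exact Literature.NumberTheory.NumberFields.exists_algEquiv_apply_ne_of_not_mem_range F Fbar hc

include D in
/-- **`G_F = Gal(F̄/F)` moves a constant of `F̄`**: `∃ (σ : F̄ ≃ₐ[F] F̄) (c : F̄), σ c ≠ c` — VERBATIM the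
hypothesis `hcoeff` of `not_exists_reconEquivariantFor_of_act_eq_refl` / `C2Residuals'.exists_act_ne_refl`,
discharged at the datum (Def. 3.1 (a), (b)). [claim: Mochizuki2012, status: disputed] -/
theorem exists_galois_apply_ne : ∃ (σ : Fbar ≃ₐ[F] Fbar) (c : Fbar), σ c ≠ c := by
  haveI := D.isAlgClosure
  exact Literature.NumberTheory.NumberFields.exists_algEquiv_apply_ne F Fbar

include D in
/-- `G_F = Gal(F̄/F)` is not the trivial group (Def. 3.1 (a), (b)). [claim: Mochizuki2012, status: disputed] -/
theorem exists_galois_ne_one : ∃ σ : Fbar ≃ₐ[F] Fbar, σ ≠ 1 := by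
  haveI := D.isAlgClosure
  exact Literature.NumberTheory.NumberFields.exists_algEquiv_ne_one F Fbar

/-- The interface Galois group `G` of `Π_{C_F} ↠ G`, acting on `F̄` through `galIso : G ≃* Gal(F̄/F)`
(`ThetaGeometry`), moves a constant (Def. 3.1 (b)). [claim: Mochizuki2012, status: disputed] -/
theorem exists_galIso_apply_ne : ∃ (g : D.geom.extF.gal) (c : Fbar), D.geom.galIso g c ≠ c := by
  obtain ⟨σ, c, h⟩ := D.exists_galois_apply_ne
  exact ⟨D.geom.galIso.symm σ, c, by rwa [MulEquiv.apply_symm_apply]⟩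

/-- **`Π_{C_F} ↠ G_F` moves a constant of `F̄`**: some `g ∈ Π_{C_F}` has `augGF g c ≠ c` for some `c ∈ F̄`
(`augGF` is onto `Gal(F̄/F)`; Def. 3.1 (b)). [claim: Mochizuki2012, status: disputed] -/
theorem exists_augGF_apply_ne : ∃ (g : D.geom.extF.arith) (c : Fbar), D.augGF g c ≠ c := by
  obtain ⟨σ, c, h⟩ := D.exists_galois_apply_ne
  obtain ⟨g, rfl⟩ := D.augGF_surjective σ
  exact ⟨g, c, h⟩

/-- Every `c ∈ F̄ ∖ F` is moved by `augGF g` for some `g ∈ Π_{C_F}` (Def. 3.1 (b)).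
[claim: Mochizuki2012, status: disputed] -/
theorem exists_augGF_apply_ne_of_not_mem_range {c : Fbar} (hc : c ∉ Set.range (algebraMap F Fbar)) :
    ∃ g : D.geom.extF.arith, D.augGF g c ≠ c := by
  obtain ⟨σ, h⟩ := D.exists_galois_apply_ne_of_not_mem_range hc
  obtain ⟨g, rfl⟩ := D.augGF_surjective σ
  exact ⟨g, h⟩

/-! ### The coefficient action on `F̄(t)` is non-trivial -/

/-- The coefficient action `f ↦ f^{augGF g}` of `g ∈ Π_{C_F}` on `F̄(t) = RatFunc F̄` moves the constant
rational function `c` whenever `augGF g` moves `c` (`ratFuncMapCoeffs_C`). [claim: Mochizuki2012, status: disputed] -/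
theorem ratFuncMapCoeffs_augGF_C_ne {g : D.geom.extF.arith} {c : Fbar} (h : D.augGF g c ≠ c) :
    ratFuncMapCoeffs (D.augGF g : Fbar →+* Fbar) (RatFunc.C c) ≠ RatFunc.C c := by
  rw [ratFuncMapCoeffs_C]
  exact fun e => h (RatFunc.C.injective e)

/-- **The recorded coefficient action of `Π_{C_F}` on `K_{C_F,NF} = F̄(t)` moves an element**:
`∃ g f, f^{augGF g} ≠ f` — the `hmove` shape of the X-143 non-transparency lemma at the action
`act _ g := ratFuncMapCoeffs (D.augGF g)` (Def. 3.1 (a), (b); [AbsTopIII] Thm. 1.9 (d) `K_{Z_NF}` is a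
`Π_X`-set through `Π_X ↠ G_k`). [claim: Mochizuki2012, status: disputed] -/
theorem exists_augGF_ratFuncMapCoeffs_ne :
    ∃ (g : D.geom.extF.arith) (f : RatFunc Fbar), ratFuncMapCoeffs (D.augGF g : Fbar →+* Fbar) f ≠ f := by
  obtain ⟨g, c, h⟩ := D.exists_augGF_apply_ne
  exact ⟨g, RatFunc.C c, D.ratFuncMapCoeffs_augGF_C_ne h⟩

/-- The same for the action through `galIso` of the Galois group `G` of the interface extension:
`∃ g f, f^{galIso g} ≠ f`. [claim: Mochizuki2012, status: disputed] -/
theorem exists_galIso_ratFuncMapCoeffs_ne :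
    ∃ (g : D.geom.extF.gal) (f : RatFunc Fbar), ratFuncMapCoeffs (D.geom.galIso g : Fbar →+* Fbar) f ≠ f := by
  obtain ⟨g, c, h⟩ := D.exists_galIso_apply_ne
  refine ⟨g, RatFunc.C c, ?_⟩
  rw [ratFuncMapCoeffs_C]
  exact fun e => h (RatFunc.C.injective e)

end InitialThetaData
end Literature.IUT.HodgeTheaters
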